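import Summits.QuantumFields.GaugeBoot.Rows.KZL2rpD4BlkDefs
import Summits.QuantumFields.GaugeBoot.Rows.KZL2rpD4Lines
import Summits.QuantumFields.GaugeBoot.Rows.SymIrrH1
import Summits.QuantumFields.GaugeBoot.Rows.SymIrrH2
import Summits.QuantumFields.GaugeBoot.Rows.SymIrrH5
import Summits.QuantumFields.GaugeBoot.Rows.SymIrrH7
import HarnessLib

/-!
# Gauge-boot: kernel check of the orbit tables, part 1/5 (blocks 0–3)

Cell `pub-gaugeboot` (HOME `run/shared/lean/pub/pub-gaugeboot/`), seat lean1 (SYMMETRY-FACTORISED torus layer for the kz-L2-rp-4D family =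
rows C91–C106 / C123–C127; label set, lines, irrep data, pair/row class certification, orbit tables, reduction identity, assembly).

HONEST FRAMING (page 1 of every file of this cell): certified bounds on lattice expectations at STATED coupling,
gauge group, dimension and torus size; NOT a mass gap, NOT a continuum limit, NOT a string tension, NOT large `N`.
The venture is explicitly NOT Yang–Mills-summit-bearing (barriers `FixedCouplingUltralocality`,
`PerturbativeInvisibility`).

For each listed block `k`: `∀ j t, t·(row line of column j) = orbit line (k, j, t)` where `t` runs over the support codes of the block's
irrep (`SymIrr.tc…`) — `decide +kernel` over nested shallow ranges (one `gactT` evaluation per entry), then the `Fin` form `orb_ok_k`.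
-/

noncomputable section

open Literature.MathematicalPhysics.QuantumFieldTheory

namespace Summit.QuantumFields.GaugeBoot

namespace KZL2rpD4

set_option maxHeartbeats 0 in
/-- Orbit table of block 0 (`H/irrep0(d1,c+)`, 11 columns × 768 support codes; kernel, nested ranges). -/
theorem orb_okN_0 : ∀ j : Fin 11, ∀ x : Fin 24, ∀ z : Fin 32, 0 + 32 * x.val + z.val < 768 → SymB4.gactT (SymIrr.tcH0 (0 + 32 * x.val + z.val)) (Sn (rowLineH (hRow 0 j.val).val)) = Sn (orbH 0 j.val (0 + 32 * x.val + z.val)).val := by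
  decide +kernel

/-- Orbit table of block 0, `Fin` form. -/
theorem orb_ok_0 (j : Fin 11) (t : Fin 768) : SymB4.gactT (SymIrr.tcH0 t.val) (Sn (rowLineH (hRow 0 j.val).val)) = Sn (orbH 0 j.val t.val).val :=
  SymB4.nested_elim (P := fun t => SymB4.gactT (SymIrr.tcH0 t) (Sn (rowLineH (hRow 0 j.val).val)) = Sn (orbH 0 j.val t).val) (lo := 0) (hi := 768) (A := 24) (B := 32) (by norm_num) (orb_okN_0 j) t.val (Nat.zero_le _) t.isLt

set_option maxHeartbeats 0 in
/-- Orbit table of block 1 (`H/irrep1(d1,c+)`, 3 columns × 768 support codes; kernel, nested ranges). -/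
theorem orb_okN_1 : ∀ j : Fin 3, ∀ x : Fin 24, ∀ z : Fin 32, 0 + 32 * x.val + z.val < 768 → SymB4.gactT (SymIrr.tcH1 (0 + 32 * x.val + z.val)) (Sn (rowLineH (hRow 1 j.val).val)) = Sn (orbH 1 j.val (0 + 32 * x.val + z.val)).val := by
  decide +kernel

/-- Orbit table of block 1, `Fin` form. -/
theorem orb_ok_1 (j : Fin 3) (t : Fin 768) : SymB4.gactT (SymIrr.tcH1 t.val) (Sn (rowLineH (hRow 1 j.val).val)) = Sn (orbH 1 j.val t.val).val :=
  SymB4.nested_elim (P := fun t => SymB4.gactT (SymIrr.tcH1 t) (Sn (rowLineH (hRow 1 j.val).val)) = Sn (orbH 1 j.val t).val) (lo := 0) (hi := 768) (A := 24) (B := 32) (by norm_num) (orb_okN_1 j) t.val (Nat.zero_le _) t.isLt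

set_option maxHeartbeats 0 in
/-- Orbit table of block 2 (`H/irrep8(d2,c+)`, 13 columns × 768 support codes; kernel, nested ranges). -/
theorem orb_okN_2 : ∀ j : Fin 13, ∀ x : Fin 24, ∀ z : Fin 32, 0 + 32 * x.val + z.val < 768 → SymB4.gactT (SymIrr.tcH8 (0 + 32 * x.val + z.val)) (Sn (rowLineH (hRow 2 j.val).val)) = Sn (orbH 2 j.val (0 + 32 * x.val + z.val)).val := by
  decide +kernel

/-- Orbit table of block 2, `Fin` form. -/
theorem orb_ok_2 (j : Fin 13) (t : Fin 768) : SymB4.gactT (SymIrr.tcH8 t.val) (Sn (rowLineH (hRow 2 j.val).val)) = Sn (orbH 2 j.val t.val).val :=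
  SymB4.nested_elim (P := fun t => SymB4.gactT (SymIrr.tcH8 t) (Sn (rowLineH (hRow 2 j.val).val)) = Sn (orbH 2 j.val t).val) (lo := 0) (hi := 768) (A := 24) (B := 32) (by norm_num) (orb_okN_2 j) t.val (Nat.zero_le _) t.isLt

set_option maxHeartbeats 0 in
/-- Orbit table of block 3 (`H/irrep12(d3,c+)`, 21 columns × 768 support codes; kernel, nested ranges). -/
theorem orb_okN_3 : ∀ j : Fin 21, ∀ x : Fin 24, ∀ z : Fin 32, 0 + 32 * x.val + z.val < 768 → SymB4.gactT (SymIrr.tcH12 (0 + 32 * x.val + z.val)) (Sn (rowLineH (hRow 3 j.val).val)) = Sn (orbH 3 j.val (0 + 32 * x.val + z.val)).val := by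
  decide +kernel

/-- Orbit table of block 3, `Fin` form. -/
theorem orb_ok_3 (j : Fin 21) (t : Fin 768) : SymB4.gactT (SymIrr.tcH12 t.val) (Sn (rowLineH (hRow 3 j.val).val)) = Sn (orbH 3 j.val t.val).val :=
  SymB4.nested_elim (P := fun t => SymB4.gactT (SymIrr.tcH12 t) (Sn (rowLineH (hRow 3 j.val).val)) = Sn (orbH 3 j.val t).val) (lo := 0) (hi := 768) (A := 24) (B := 32) (by norm_num) (orb_okN_3 j) t.val (Nat.zero_le _) t.isLt

end KZL2rpD4

end Summit.QuantumFields.GaugeBoot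

end
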